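import Literature.AlgebraicGeometry.Resolution.QuasiProjectiveResolution
import Literature.AlgebraicGeometry.Resolution.ResolutionOfSingularities
import Literature.RingTheory.TightClosure.RegularTightlyClosed
import Mathlib.AlgebraicGeometry.Morphisms.Proper
import Mathlib.Algebra.CharP.Algebra
import HarnessLib

/-!
# Crux `FRationalResolution`, line `redirect`: the stubs `stub_isolatedFRegularization` and `stub_spreadOut` follow from a resolution

Support file for crux stmt-ResolutionOfSingularities-15317 (`FrobeniusLadder.FRationalResolution`), skeleton of record
31452a5ba582e46f (line `redirect`). KILL-CRITERION bookkeeping for two of the four registered open stubs, in the manner of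
`stub_rungsOfSummit` (rungs 3½/4′) and of `FRationalModification.IsolateDefectOfHasResolution` (crux 15316): the CONCLUSIONS of
`stub_isolatedFRegularization` and of `stub_spreadOut` hold for every separated finite-type `X/k` (`char k = p` prime) that
admits a resolution of singularities — with the resolution itself as the model. Along a resolution `π : X' → X` every stalk
is a regular local ring of characteristic `p`, hence a domain with EVERY ideal tightly closed (`weaklyFRegular_stalk_of_isResolution`:
Hochster–Huneke via Kunz), a fortiori F-rational; `X'` is integral when `X` is (reduced with domain stalks, irreducible by
`IsBirational.irreducibleSpace`); and the «bad set» of `stub_spreadOut` is EMPTY.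

* `isolatedFRegularization_of_hasResolution`, `spreadOut_of_hasResolution` — the two implications (no use of the stubs'
  F-singularity hypotheses: they are consequences of `Scheme.HasResolution X` alone);
* `isolatedFRegularization_of_cossartPiltant2019_of_dim_le_three`, `spreadOut_of_cossartPiltant2019_of_dim_le_three` — hence both
  stub conclusions hold in dimension `≤ 3` CONDITIONALLY on the named fact `CossartPiltant2019` (`hasResolution_of_dim_le_three`).
So neither stub is refutable short of `¬ResolutionOfSingularities`, and each is open exactly where the summit is (dimension `≥ 4`).
(`stub_diagonalizableQuotientResolution` concludes `Scheme.HasResolution X` itself; `stub_quotientModel` follows from a resolution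
too — trivial grading on an affine regular chart — but that certificate is not typed here.) [folklore; HochsterHuneke1990 Thm. 4.4;
StacksProject Tag 01RN]
-/

-- single-problem summit: the doubled namespace component is forced
set_option linter.dupNamespace false

noncomputable section

open CategoryTheory AlgebraicGeometry TopologicalSpace
open Literature.AlgebraicGeometry.Resolution Literature.RingTheory.TightClosure

namespace Summit.ResolutionOfSingularities.ResolutionOfSingularities.Theorems.FRationalResolution

/-- The source of a resolution of an integral scheme is integral: reduced (regular stalks are domains,
`isDomain_of_isRegularLocalRing`, `isReduced_of_isReduced_stalk`) and irreducible (birational onto an irreducible scheme,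
`IsBirational.irreducibleSpace`). [folklore] -/
theorem isIntegral_of_isResolution {X' X : Scheme.{0}} [IsIntegral X] {π : X' ⟶ X} (hπ : IsResolution π) :
    IsIntegral X' := by
  haveI : ∀ x : X', _root_.IsReduced (X'.presheaf.stalk x) := fun x => by
    haveI : IsRegularLocalRing (X'.presheaf.stalk x) := hπ.isRegular x
    haveI : IsDomain (X'.presheaf.stalk x) := isDomain_of_isRegularLocalRing _
    infer_instance
  haveI : IsReduced X' := isReduced_of_isReduced_stalk X'
  haveI : IrreducibleSpace X' := IsBirational.irreducibleSpace hπ.isBirational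
  exact isIntegral_of_irreducibleSpace_of_isReduced X'

/-- Along a resolution `π : X' → X` of a scheme over a field of prime characteristic `p`, every stalk of `X'` is a domain in
which every ideal is tightly closed (inline form): a regular local ring (`hπ.isRegular`) is a domain
(`isDomain_of_isRegularLocalRing`) of characteristic `p` (through `k → Γ(Spec k) → Γ(X') → 𝒪_{X',x}`), and every ideal of it is
tightly closed (`isTightlyClosed_of_isRegularLocalRing`, unfolded by `isTightlyClosed_iff_of_isDomain`). (Cf.
`weaklyFRegular_stalk_of_isRegular` of `…RungsIff.lean`, stated for `Scheme.IsRegular`; here from `IsResolution`.)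
[folklore; HochsterHuneke1990 Thm. 4.4] -/
theorem weaklyFRegular_stalk_of_isResolution {p : ℕ} (hp : p.Prime) (k : Type) [Field k] [CharP k p]
    {X' X : Scheme.{0}} {π : X' ⟶ X} (hπ : IsResolution π) (f : X ⟶ Spec (.of k)) (x : X') :
    IsDomain (X'.presheaf.stalk x) ∧ ∀ I : Ideal (X'.presheaf.stalk x),
      ∀ y c : X'.presheaf.stalk x, c ≠ 0 →
      (∀ e : ℕ, c * y ^ p ^ e ∈ Ideal.span ((fun z : X'.presheaf.stalk x => z ^ p ^ e) ''
        (I : Set (X'.presheaf.stalk x)))) → y ∈ I := by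
  haveI : Fact p.Prime := ⟨hp⟩
  haveI : IsRegularLocalRing (X'.presheaf.stalk x) := hπ.isRegular x
  haveI : IsDomain (X'.presheaf.stalk x) := isDomain_of_isRegularLocalRing _
  haveI : CharP (X'.presheaf.stalk x) p :=
    CharP.of_ringHom_of_ne_zero
      ((X'.presheaf.germ ⊤ x trivial).hom.comp ((π ≫ f).appTop.hom.comp (Scheme.ΓSpecIso (.of k)).inv.hom)) p hp.ne_zero
  exact ⟨inferInstance, fun I => (isTightlyClosed_iff_of_isDomain p).mp (isTightlyClosed_of_isRegularLocalRing p I)⟩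

/-- **`stub_isolatedFRegularization` ⟸ a resolution.** If the separated finite-type `X/k` (`char k = p` prime) has a resolution
of singularities `π : X' → X`, then `π` is a proper birational model all of whose stalks are domains with every ideal tightly
closed (inline clause): regular local rings of characteristic `p` are (`weaklyFRegular_stalk_of_isResolution`). The stub's
hypotheses (F-rational stalks, finite non-F-regular locus) are not used. [folklore; HochsterHuneke1990 Thm. 4.4] -/
theorem isolatedFRegularization_of_hasResolution (p : ℕ) (hp : p.Prime) (k : Type) [Field k] [CharP k p]
    (X : Scheme.{0}) (f : X ⟶ Spec (.of k)) (hres : Scheme.HasResolution X) :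
    ∃ (X' : Scheme.{0}) (π : X' ⟶ X), IsProper π ∧ IsBirational π ∧
      ∀ x : X', IsDomain (X'.presheaf.stalk x) ∧ ∀ I : Ideal (X'.presheaf.stalk x),
        ∀ y c : X'.presheaf.stalk x, c ≠ 0 →
        (∀ e : ℕ, c * y ^ p ^ e ∈ Ideal.span ((fun z : X'.presheaf.stalk x => z ^ p ^ e) ''
          (I : Set (X'.presheaf.stalk x)))) → y ∈ I := by
  obtain ⟨X', π, hπ⟩ := hres
  exact ⟨X', π, hπ.isProper, hπ.isBirational, weaklyFRegular_stalk_of_isResolution hp k hπ f⟩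

/-- **`stub_spreadOut` ⟸ a resolution.** If the integral separated finite-type `X/k` (`char k = p` prime) has a resolution of
singularities `π : X' → X`, then `π` is a proper birational INTEGRAL model (`isIntegral_of_isResolution`) whose stalks satisfy
the F-rational clause (they are weakly F-regular domains, `weaklyFRegular_stalk_of_isResolution`) and whose set of points with
stalk neither weakly F-regular nor «Gorenstein» is EMPTY, in particular finite. [folklore; HochsterHuneke1990 Thm. 4.4] -/
theorem spreadOut_of_hasResolution (p : ℕ) (hp : p.Prime) (k : Type) [Field k] [CharP k p]
    (X : Scheme.{0}) (f : X ⟶ Spec (.of k)) [IsIntegral X] (hres : Scheme.HasResolution X) :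
    ∃ (X' : Scheme.{0}) (π : X' ⟶ X), IsProper π ∧ IsBirational π ∧ IsIntegral X' ∧
      (∀ x : X', IsDomain (X'.presheaf.stalk x) ∧ ∀ d : ℕ, ringKrullDim (X'.presheaf.stalk x) = d →
        ∀ s : Fin d → X'.presheaf.stalk x, (Ideal.span (Set.range s)).radical.IsMaximal →
        ∀ y c : X'.presheaf.stalk x, c ≠ 0 →
        (∀ e : ℕ, c * y ^ p ^ e ∈ Ideal.span ((fun z : X'.presheaf.stalk x => z ^ p ^ e) ''
          (Ideal.span (Set.range s) : Set (X'.presheaf.stalk x)))) → y ∈ Ideal.span (Set.range s)) ∧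
      Set.Finite {x : X' | ¬ ((∀ I : Ideal (X'.presheaf.stalk x), ∀ y c : X'.presheaf.stalk x, c ≠ 0 →
          (∀ e : ℕ, c * y ^ p ^ e ∈ Ideal.span ((fun z : X'.presheaf.stalk x => z ^ p ^ e) ''
            (I : Set (X'.presheaf.stalk x)))) → y ∈ I) ∨
        (∀ d : ℕ, ringKrullDim (X'.presheaf.stalk x) = d → ∀ s : Fin d → X'.presheaf.stalk x,
          (Ideal.span (Set.range s)).radical.IsMaximal →
          ∃ t : X'.presheaf.stalk x, (Ideal.span (Set.range s)).colon
            (IsLocalRing.maximalIdeal (X'.presheaf.stalk x) : Set (X'.presheaf.stalk x)) =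
            Ideal.span (Set.range s) ⊔ Ideal.span {t}))} := by
  obtain ⟨X', π, hπ⟩ := hres
  have hW := weaklyFRegular_stalk_of_isResolution hp k hπ f
  refine ⟨X', π, hπ.isProper, hπ.isBirational, isIntegral_of_isResolution hπ,
    fun x => ⟨(hW x).1, fun d _ s _ y c hc hy => (hW x).2 (Ideal.span (Set.range s)) y c hc hy⟩, ?_⟩
  exact Set.finite_empty.subset fun x hx => hx (Or.inl (hW x).2)

/-- **`stub_isolatedFRegularization` in dimension `≤ 3`, modulo Cossart–Piltant.** Conditional on the named fact
`CossartPiltant2019` (resolution of reduced separated finite-type schemes of dimension `≤ 3` over any field): the conclusion of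
the stub holds for every integral separated finite-type `X/k` of dimension `≤ 3`, with no F-singularity hypothesis.
[OURS · conditional on the named fact; cite: CossartPiltant2019, Thm. 1.1] -/
theorem isolatedFRegularization_of_cossartPiltant2019_of_dim_le_three (hCP : CossartPiltant2019.{0}) (p : ℕ) (hp : p.Prime)
    (k : Type) [Field k] [CharP k p] (X : Scheme.{0}) (f : X ⟶ Spec (.of k)) [IsSeparated f] [LocallyOfFiniteType f]
    [QuasiCompact f] [IsIntegral X] (hdim : topologicalKrullDim X ≤ 3) :
    ∃ (X' : Scheme.{0}) (π : X' ⟶ X), IsProper π ∧ IsBirational π ∧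
      ∀ x : X', IsDomain (X'.presheaf.stalk x) ∧ ∀ I : Ideal (X'.presheaf.stalk x),
        ∀ y c : X'.presheaf.stalk x, c ≠ 0 →
        (∀ e : ℕ, c * y ^ p ^ e ∈ Ideal.span ((fun z : X'.presheaf.stalk x => z ^ p ^ e) ''
          (I : Set (X'.presheaf.stalk x)))) → y ∈ I :=
  isolatedFRegularization_of_hasResolution p hp k X f (hasResolution_of_dim_le_three hCP (p := p) k X f hdim)

/-- **`stub_spreadOut` in dimension `≤ 3`, modulo Cossart–Piltant.** Conditional on the named fact `CossartPiltant2019`: the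
conclusion of the stub holds for every integral separated finite-type `X/k` of dimension `≤ 3`, with no F-singularity
hypothesis. [OURS · conditional on the named fact; cite: CossartPiltant2019, Thm. 1.1] -/
theorem spreadOut_of_cossartPiltant2019_of_dim_le_three (hCP : CossartPiltant2019.{0}) (p : ℕ) (hp : p.Prime)
    (k : Type) [Field k] [CharP k p] (X : Scheme.{0}) (f : X ⟶ Spec (.of k)) [IsSeparated f] [LocallyOfFiniteType f]
    [QuasiCompact f] [IsIntegral X] (hdim : topologicalKrullDim X ≤ 3) :
    ∃ (X' : Scheme.{0}) (π : X' ⟶ X), IsProper π ∧ IsBirational π ∧ IsIntegral X' ∧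
      (∀ x : X', IsDomain (X'.presheaf.stalk x) ∧ ∀ d : ℕ, ringKrullDim (X'.presheaf.stalk x) = d →
        ∀ s : Fin d → X'.presheaf.stalk x, (Ideal.span (Set.range s)).radical.IsMaximal →
        ∀ y c : X'.presheaf.stalk x, c ≠ 0 →
        (∀ e : ℕ, c * y ^ p ^ e ∈ Ideal.span ((fun z : X'.presheaf.stalk x => z ^ p ^ e) ''
          (Ideal.span (Set.range s) : Set (X'.presheaf.stalk x)))) → y ∈ Ideal.span (Set.range s)) ∧
      Set.Finite {x : X' | ¬ ((∀ I : Ideal (X'.presheaf.stalk x), ∀ y c : X'.presheaf.stalk x, c ≠ 0 →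
          (∀ e : ℕ, c * y ^ p ^ e ∈ Ideal.span ((fun z : X'.presheaf.stalk x => z ^ p ^ e) ''
            (I : Set (X'.presheaf.stalk x)))) → y ∈ I) ∨
        (∀ d : ℕ, ringKrullDim (X'.presheaf.stalk x) = d → ∀ s : Fin d → X'.presheaf.stalk x,
          (Ideal.span (Set.range s)).radical.IsMaximal →
          ∃ t : X'.presheaf.stalk x, (Ideal.span (Set.range s)).colon
            (IsLocalRing.maximalIdeal (X'.presheaf.stalk x) : Set (X'.presheaf.stalk x)) =
            Ideal.span (Set.range s) ⊔ Ideal.span {t}))} :=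
  spreadOut_of_hasResolution p hp k X f (hasResolution_of_dim_le_three hCP (p := p) k X f hdim)

end Summit.ResolutionOfSingularities.ResolutionOfSingularities.Theorems.FRationalResolution

end
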